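import Summits.BirchSwinnertonDyer.BirchSwinnertonDyer.Theorems.KatoDescentPotSupersingularWildUpperOptimalSharpRoadJ08S2b
import Summits.BirchSwinnertonDyer.BirchSwinnertonDyer.Theorems.KatoDescentPotSupersingularWildUpperHeegnerSharpRoad
import Summits.BirchSwinnertonDyer.BirchSwinnertonDyer.Theorems.KimAtThreeKolyvaginIsogenyTransport
import Summits.BirchSwinnertonDyer.BirchSwinnertonDyer.Theorems.SmallImageMuTransferMuTransferStubCm
import Summits.BirchSwinnertonDyer.Rank1Residual.X12.InertCoreEveryCurve
import Summits.BirchSwinnertonDyer.Rank1Residual.O6.X3WildOfKMCTorsionFreeMember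
import Literature.NumberTheory.EllipticCurves.IsogenyQuadraticTwistProofs
import HarnessLib

/-!
# Route `KatoDescentPotSupersingular` (rung K9, wild `3`, cell `bsd-potss`) — the U₀-ns node through the optimal member with
# the `q = p` schema WEAKENED by «`2` splits in `K`» (`SatisfiesHeegnerHypothesis 2 K`; variant of
# `…WildUpperOptimalSharpNodesJ08` / `…NodesJ08D4`; seat `bsd-potss-k9-c4` g11; route-free; PREPARED for the one-binder
# restatement of crux 19941; nothing booked, no item closed, BSD is not proved)

This is `…WildUpperOptimalSharpNodesJ08` byte-for-byte with BOTH Heegner readings displayed as schemas carrying the one extra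
binder `SatisfiesHeegnerHypothesis 2 K →` (after `SatisfiesHeegnerHypothesis N K →`): `hJ2` (the body of
`Jetchev2008.cor15_irreducibleReading_…` + binder) and `hJp2` (crux 19941's body + binder), and the road call pointed at
`WildUpperOptimalSharpRoadJ08S2b.missingUpperBoundAt_rankZero_of_optimalDatum_of_jetchev08TwoSplit_of_boundAtPTwoSplit`.
With crux 19941 restated accordingly and K9's (H♯) input re-keyed to a cell-own two-split decl (both = conclusions of this seat's
`JetchevIrreducibleSwapAtP.wildJetchevBoundAtPTwoSplit_of_namedFacts` / `…cor15_irreducibleReadingTwoSplit_of_namedFacts`, i.e. BOTH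
⟸ {MN19 Thm. 0.7, Gross 3.7 (2), Poitou–Tate, GZ86 III (3.1)} + `PublishedInputsHeegner`), glue 20173 re-closes by
`fun hJ hJp hH hC₄ hCS h₂ hR hK hF => WildUpperOptimalSharpNodesJ08S2b.wildUpperNonsurjTower_of_jetchev08TwoSplit_of_boundAtPTwoSplit_of_cruxAResidue hJ hJp hH.1 hH.2.1 hH.2.2.1 hH.2.2.2.1 hH.2.2.2.2 hC₄ hCS h₂ hR hK hF`
(cert `HOME/k9-c4/g11/GlueCertJ08S2b.lean`). Conditional on the displayed schemas; nothing asserted; NO item closed.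

References: [Jetchev2008] Thm. 1.4, Cor. 1.5 (p. 3), Rem. 6.2 (p. 15); [MatarNekovar2019] Thm. 0.3, §0.11; [MilneADT2006] Thm. I.7.3;
[Kato2004Asterisque] Thm. 14.5 (3); [CoatesSujatha2005] Conj. A; [BurungaleFlach2024] Thm. 1.1; [CremonaAlgorithms1997] §3.9.
-/

set_option autoImplicit false
-- the Theorems directory repeats the summit name (sibling precedent `KatoDescentPotSupersingularAssembly.lean`)
set_option linter.dupNamespace false

noncomputable section

open scoped Classical NumberField

namespace Summit.BirchSwinnertonDyer.BirchSwinnertonDyer.Theorems.WildUpperOptimalSharpNodesJ08S2b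

open WeierstrassCurve IsDedekindDomain IsDedekindDomain.HeightOneSpectrum NumberField
  Rat.HeightOneSpectrum Literature.NumberTheory.EllipticCurves
  Literature.NumberTheory.EllipticCurves.ModularForms
  Literature.NumberTheory.DiophantineGeometry
  Literature.NumberTheory.EllipticCurves.Rank1Residual
  Literature.NumberTheory.EllipticCurves.Rank1Residual.Typed
  Literature.NumberTheory.Automorphic Literature.NumberTheory.EllipticCurves.KrizLi2019
  Literature.NumberTheory.QuadraticFields
  Summit.BirchSwinnertonDyer.Rank1Residual
  Summit.BirchSwinnertonDyer.Rank1Residual.Additive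
  Summit.BirchSwinnertonDyer.Rank1Residual.O6
  Summit.BirchSwinnertonDyer.BirchSwinnertonDyer.Theorems
  Summit.BirchSwinnertonDyer.BirchSwinnertonDyer.Theorems.WildUpperOptimalSharpRoadJ08S2b

/-! ### §1 Private re-homings (the fine-Selmer port; rationality) -/

/-- **Rank-`0` upper bound with the torsion term from the fine-Selmer reading** (private re-homing of g0's lemma,
as in the K9 sharp road): at an odd additive potentially good `p` with `E[p]` irreducible and `Y(E/ℚ^cyc)` finitely
generated over `ℤ_p` (`hA`), `#Ш_an = q` and `ord_p #Ш ≤ ord_p q − 2 ord_p #E(ℚ)_tors`.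
[cite: Kato2004Asterisque, Thm. 14.5 (3) (p. 236), Thm. 12.5 (3) (p. 222), 14.14 (p. 243), Prop. 14.16 (2) (p. 244)]
[cite: Lim2017FineSelmer, §3] [cite: Miller2011LMS, Def. 1.1] -/
private theorem padicValNat_shaOrder_le_of_katoFineSelmer_rankZero
    (hKatoA :
      Kato2004.rankZero_padicValNat_sha_add_padicValNat_tamagawa_le_of_additive_potGood_of_irreducible_of_fineSelmerDual_fg)
    (hGZK : rank_eq_analyticRank_of_analyticRank_le_one) (hmod : hasEntireLFunction_rat)
    (W : WeierstrassCurve ℚ) [W.IsElliptic] [W.IsGloballyMinimal] (p : ℕ) [Fact p.Prime]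
    (hp : p ≠ 2) (hgood : ¬ W.HasGoodReductionAtPrime p) (hmult : ¬ W.HasMultiplicativeReductionAtPrime p)
    (hpot : 0 ≤ padicValRat p W.j) (hirr : W.HasIrreducibleModPGaloisRep p)
    (hA : ∀ (κ : ZpExtension ℚ p), κ.IsCyclotomic →
      ∃ (γ : Field.absoluteGaloisGroup ℚ) (D : W.FineSelmerDualData κ γ),
        Module.Finite ℤ_[p] (RestrictScalars ℤ_[p] (IwasawaAlgebra p) D.X))
    (hr : W.analyticRank = 0) :
    ∃ q : ℚ, shaAn W = (q : ℂ) ∧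
      (padicValNat p W.shaOrder : ℤ) ≤ padicValRat p q - 2 * padicValNat p W.torsionOrder := by
  have hL : W.entireLFunction 1 ≠ 0 := (W.analyticRank_eq_zero_iff_holds (hmod W)).mp hr
  obtain ⟨hmw, hfin⟩ := hGZK W (by rw [hr]; exact zero_le_one)
  haveI : Finite W.sha := hfin
  have hmw0 : W.mordellWeilRank = 0 := by rw [hmw, hr]
  obtain ⟨q₀, hq₀, hle⟩ := hKatoA W p hp hgood hmult hpot hirr hA hL hfin
  have hΩpos : 0 < W.realPeriodRat := W.realPeriodRat_pos_holds
  have hΩ : (W.realPeriodRat : ℂ) ≠ 0 := by exact_mod_cast hΩpos.ne'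
  have hc0 : 0 < W.tamagawaProduct := W.tamagawaProduct_pos_holds
  have ht0 : 0 < W.torsionOrder := W.torsionOrder_pos_holds
  have hq₀0 : q₀ ≠ 0 := by
    rintro rfl
    rw [Rat.cast_zero, div_eq_zero_iff] at hq₀
    exact hq₀.elim hL hΩ
  refine ⟨q₀ * (W.torsionOrder : ℚ) ^ 2 / (W.tamagawaProduct : ℚ), ?_, ?_⟩
  · have hLq : W.entireLFunction 1 = (q₀ : ℂ) * (W.realPeriodRat : ℂ) := by
      rw [← hq₀, div_mul_cancel₀ _ hΩ]
    rw [shaAn_def, W.leadingLCoeff_eq_of_analyticRank_eq_zero hr,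
      W.regulator_eq_one_of_rank_zero hmw0, hLq]
    push_cast
    field_simp
  · have ht : (W.torsionOrder : ℚ) ≠ 0 := by exact_mod_cast ht0.ne'
    have hcq : (W.tamagawaProduct : ℚ) ≠ 0 := by exact_mod_cast hc0.ne'
    have hsha : padicValNat p (Nat.card (AddCommGroup.primaryComponent W.sha p)) =
        padicValNat p W.shaOrder := by
      unfold WeierstrassCurve.shaOrder
      exact padicValNat_card_addPrimaryComponent p
    have hv : padicValRat p (q₀ * (W.torsionOrder : ℚ) ^ 2 / (W.tamagawaProduct : ℚ)) =
        padicValRat p q₀ + 2 * (padicValNat p W.torsionOrder : ℤ) -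
          (padicValNat p W.tamagawaProduct : ℤ) := by
      rw [padicValRat.div (mul_ne_zero hq₀0 (pow_ne_zero 2 ht)) hcq,
        padicValRat.mul hq₀0 (pow_ne_zero 2 ht), pow_two, padicValRat.mul ht ht,
        padicValRat.of_nat, padicValRat.of_nat]
      ring
    rw [hv, ← hsha]
    linarith

/-- **Rationality of `L(E,1)/Ω_E` from the rationality of `#Ш(E)_an` in analytic rank `0`** (`Reg = 1` by GZK;
private re-homing). [cite: Miller2011LMS, Def. 1.1] -/
private theorem exists_ratio_rat_of_shaAn_rat_rankZero (hGZK : rank_eq_analyticRank_of_analyticRank_le_one)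
    (W : WeierstrassCurve ℚ) [W.IsElliptic] (hr : W.analyticRank = 0) {q : ℚ}
    (hq : shaAn W = (q : ℂ)) :
    ∃ q0 : ℚ, W.entireLFunction 1 / (W.realPeriodRat : ℂ) = (q0 : ℂ) := by
  have hmw0 : W.mordellWeilRank = 0 := by rw [(hGZK W (by rw [hr]; exact zero_le_one)).1, hr]
  have hΩ : (W.realPeriodRat : ℂ) ≠ 0 := by exact_mod_cast W.realPeriodRat_pos_holds.ne'
  have ht : (W.torsionOrder : ℂ) ≠ 0 := by exact_mod_cast W.torsionOrder_pos_holds.ne'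
  have hc : (W.tamagawaProduct : ℂ) ≠ 0 := by exact_mod_cast W.tamagawaProduct_pos_holds.ne'
  rw [shaAn_def, W.leadingLCoeff_eq_of_analyticRank_eq_zero hr, W.regulator_eq_one_of_rank_zero hmw0]
    at hq
  simp only [Complex.ofReal_one, mul_one] at hq
  refine ⟨q * W.tamagawaProduct / (W.torsionOrder : ℚ) ^ 2, ?_⟩
  push_cast
  rw [← hq]
  field_simp

/-! ### §2 The BODY of the U₀-ns node `WildUpperNonsurjTower` through the optimal member of the class -/

/-- **The BODY of the K9 U₀-ns node `WildUpperNonsurjTower` (item 19189) from: the two JETCHEV READINGS `hJr`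
(`q ≠ 3`) and `hJp` (`q = 3`) of `…WildUpperOptimalSharpRoad` (displayed schemas in the vocabulary of
`Jetchev2008.cor15_padicValNat_card_primaryComponent_sha_le`: optimal datum with `3 ∤ c`, `3`-primary `Ш`, ONE
Tamagawa prime; additive potentially good, rank `0`, non-CM, `E[3]` irreducible, `3`-adic tower not onto — NOT
theorems of the tree, NOT asserted), the Heegner-road published facts and CASSELS' isogeny invariance,
COATES–SUJATHA'S (A) ONLY ON THE RESIDUE ROWS (`hCS`: an optimal isogenous member with `3 ∣ c`, or with the
`3`-part of `∏c_ℓ` on no single bad prime `q` — `q = 3`, or `q ≠ 3` multiplicative with `3 ∤ c₃` —), and the BODIES of the K9 items L₀ (19195), `WildRankOne` (19200),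
`KatoTamagawaExactInputs`, `PublishedInputsFineSelmerCM`.** Rows: CM → Burungale–Flach; residue → the fine-Selmer
port + (A) at `W`; otherwise the prequel at the OPTIMAL member `W₀` (transports along the isogeny; rationality
and the twists' lower halves carried from `W` by Cassels; the result carried back by Cassels). Conditional;
nothing asserted; NO item is closed; BSD is not proved by any of this.
[cite: Jetchev2008, Hypothesis (*), Thm. 1.4, Cor. 1.5 (p. 3), Lemma 4.3, 4.5 (p. 9), Rem. 6.2 (p. 15)]
[cite: MatarNekovar2019, Thm. 0.3 (p. 456), §0.11 (p. 457)] [cite: MilneADT2006, Thm. I.7.3 and Remark I.7.4]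
[cite: Kato2004Asterisque, Thm. 14.5 (3) (p. 236)] [cite: CoatesSujatha2005, Conjecture A]
[cite: BurungaleFlach2024, Thm. 1.1 and Cor. 2 (p. 4)] [cite: CremonaAlgorithms1997, §3.9 (p. 87)] -/
theorem wildUpperNonsurjTower_of_jetchev08TwoSplit_of_boundAtPTwoSplit_of_cruxAResidue
    (hJ : ∀ (N : ℕ) [NeZero N] (W : WeierstrassCurve ℚ) [W.IsElliptic] [W.IsGloballyMinimal]
      (K : Type) [Field K] [NumberField K],
      IsImaginaryQuadratic K → NumberField.discr K ≠ -3 → NumberField.discr K ≠ -4 →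
      SatisfiesHeegnerHypothesis N K → SatisfiesHeegnerHypothesis 2 K →
      ∀ (p : ℕ) [Fact p.Prime], p ≠ 2 → W.analyticRank = 0 → Addv W p → 0 ≤ padicValRat p W.j →
      ¬ W.HasCM → W.HasIrreducibleModPGaloisRep p →
      ¬ (∀ n : ℕ, W.HasSurjectiveModNGaloisRep (p ^ n : ℕ)) →
      (∃ Dt : ModularParametrizationData W N,
        (∀ z ∈ Dt.L.lattice, ∃ w ∈ periodLattice Dt.f, z = (Dt.c : ℂ) * w) ∧ ¬ (p : ℤ) ∣ Dt.c) →
      ¬ p ∣ (W.baseChange ℚ_[p]).localTamagawaNumber ℤ_[p] →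
      (∀ (q' : ℕ) [Fact q'.Prime], q' ∣ N →
        p ∣ (W.baseChange ℚ_[q']).localTamagawaNumber ℤ_[q'] → ¬ q' ^ 2 ∣ N) →
      ∀ {P : (W.baseChange K).toAffine.Point}, IsHeegnerPoint N W K P → ¬ IsOfFinAddOrder P →
      ∀ (q : ℕ) [Fact q.Prime], q ∣ N → ¬ q ^ 2 ∣ N → q ≠ p →
      padicValNat p (Nat.card (AddCommGroup.primaryComponent (W.baseChange K).sha p)) +
          2 * padicValNat p ((W.baseChange ℚ_[q]).localTamagawaNumber ℤ_[q]) ≤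
        2 * padicValNat p (AddSubgroup.zmultiples P).index)
    (hJp : ∀ (N : ℕ) [NeZero N] (W : WeierstrassCurve ℚ) [W.IsElliptic] [W.IsGloballyMinimal]
      (K : Type) [Field K] [NumberField K],
      IsImaginaryQuadratic K → NumberField.discr K ≠ -3 → SatisfiesHeegnerHypothesis N K →
      SatisfiesHeegnerHypothesis 2 K →
      ∀ (p : ℕ) [Fact p.Prime], p ≠ 2 → W.analyticRank = 0 → Addv W p → 0 ≤ padicValRat p W.j →
      ¬ W.HasCM → W.HasIrreducibleModPGaloisRep p → ¬ (∀ n : ℕ, W.HasSurjectiveModNGaloisRep (p ^ n : ℕ)) →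
      (∃ Dt : ModularParametrizationData W N,
        (∀ z ∈ Dt.L.lattice, ∃ w ∈ periodLattice Dt.f, z = (Dt.c : ℂ) * w) ∧ ¬ (p : ℤ) ∣ Dt.c) →
      ∀ {P : (W.baseChange K).toAffine.Point}, IsHeegnerPoint N W K P → ¬ IsOfFinAddOrder P →
      p ∣ N →
      padicValNat p (Nat.card (AddCommGroup.primaryComponent (W.baseChange K).sha p)) +
          2 * padicValNat p ((W.baseChange ℚ_[p]).localTamagawaNumber ℤ_[p]) ≤
        2 * padicValNat p (AddSubgroup.zmultiples P).index)
    (hGZ : ∀ (N : ℕ) [NeZero N] (W : WeierstrassCurve ℚ) (K : Type) [Field K] [NumberField K],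
      gross_zagier N W K)
    (hKo : ∀ (N : ℕ) [NeZero N] (W : WeierstrassCurve ℚ) (K : Type) [Field K] [NumberField K],
      kolyvagin N W K)
    (hMN : ∀ (N : ℕ) [NeZero N] (W : WeierstrassCurve ℚ) (K : Type) [Field K] [NumberField K],
      MatarNekovar2019.thm03_padicValNat_card_sha_le_of_irreducible N W K)
    (hnf : exists_isNewformOf) (hBFH : bumpFriedbergHoffstein_exists_heegnerField_split_twist_simpleZero)
    (hCassels : bsdRHS_eq_of_isIsogenous)
    (hCS : ∀ (W : WeierstrassCurve ℚ) [W.IsElliptic] [W.IsGloballyMinimal] [Fact (3 : ℕ).Prime],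
      W.analyticRank = 0 → ClassO6 W 3 → W.HasIrreducibleModPGaloisRep 3 →
      ¬ (∀ n : ℕ, W.HasSurjectiveModNGaloisRep (3 ^ n : ℕ)) → ¬ W.HasCM →
      (∃ (W₀ : WeierstrassCurve ℚ) (_ : W₀.IsElliptic) (_ : W₀.IsGloballyMinimal)
          (_ : NeZero (W₀.conductorNorm ℤ)) (D₀ : ModularParametrizationData W₀ (W₀.conductorNorm ℤ)),
        IsIsogenous W W₀ ∧ (∀ z ∈ D₀.L.lattice, ∃ w ∈ periodLattice D₀.f, z = (D₀.c : ℂ) * w) ∧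
        ((3 : ℤ) ∣ D₀.c ∨ (3 ∣ W₀.tamagawaProduct ∧
          ¬ ∃ (q : ℕ) (_ : Fact q.Prime), q ∣ W₀.conductorNorm ℤ ∧
            (q ≠ 3 → ¬ q ^ 2 ∣ W₀.conductorNorm ℤ ∧ ¬ 3 ∣ (W₀.baseChange ℚ_[3]).localTamagawaNumber ℤ_[3]) ∧
            padicValNat 3 W₀.tamagawaProduct ≤
              padicValNat 3 ((W₀.baseChange ℚ_[q]).localTamagawaNumber ℤ_[q])))) →
      ∀ (κ : ZpExtension ℚ 3), κ.IsCyclotomic →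
        ∃ (γ : Field.absoluteGaloisGroup ℚ) (Df : W.FineSelmerDualData κ γ),
          Module.Finite ℤ_[3] (RestrictScalars ℤ_[3] (IwasawaAlgebra 3) Df.X))
    (h₂ : ∀ (W : WeierstrassCurve ℚ) [W.IsElliptic] [W.IsGloballyMinimal] [Fact (3 : ℕ).Prime],
      W.analyticRank = 0 → ClassO6 W 3 → MissingLowerBoundAt W 3)
    (hR : ∀ (W : WeierstrassCurve ℚ) [W.IsElliptic] [W.IsGloballyMinimal] [Fact (3 : ℕ).Prime],
      W.analyticRank = 1 → ClassO6 W 3 → MissingPPartAt W 3)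
    (hK : Kato2004.rankZero_padicValNat_sha_add_padicValNat_tamagawa_le_of_additive_potGood_of_imageContainsSL2 ∧
      rank_eq_analyticRank_of_analyticRank_le_one ∧ WeierstrassCurve.hasEntireLFunction_rat)
    (hF : Kato2004.rankZero_padicValNat_sha_add_padicValNat_tamagawa_le_of_additive_potGood_of_irreducible_of_fineSelmerDual_fg ∧
      bsdTriple_of_hasCM_of_L_one_ne_zero) :
    ∀ (W : WeierstrassCurve ℚ) [W.IsElliptic] [W.IsGloballyMinimal] [Fact (3 : ℕ).Prime],
      W.analyticRank = 0 → ClassO6 W 3 → W.HasIrreducibleModPGaloisRep 3 →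
      ¬ (∀ n : ℕ, W.HasSurjectiveModNGaloisRep (3 ^ n : ℕ)) → MissingUpperBoundAt W 3 := by
  obtain ⟨-, hGZK, hmod⟩ := hK
  intro W _ _ _ hr hO hI hnsT
  haveI : NeZero (W.conductorNorm ℤ) := ⟨(conductorNorm_pos_holds W).ne'⟩
  have hp2 : (3 : ℕ) ≠ 2 := hO.1
  have hadd : Addv W 3 := hO.2.1
  have hj : 0 ≤ padicValRat 3 W.j := hO.padicValRat_j_nonneg
  -- CM rows: Burungale–Flach
  by_cases hcm : W.HasCM
  · haveI : Finite W.sha := (hGZK W (by rw [hr]; exact zero_le_one)).2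
    exact (lower_and_upper_of_missingPPartAt W 3 (missingPPartAt_of_bsdp W 3
      (Summit.BirchSwinnertonDyer.Rank1Residual.bsdp_cm_rankZero hF.2 hmod hcm hr))).2
  -- the optimal member of the class and its lattice-optimal datum (Modularity)
  obtain ⟨W₀, hE₀, hM₀, hNZ₀, D₀, hiso, hN, hopt⟩ := X12.exists_isIsogenous_optimal hnf W
  -- the residue rows: the fine-Selmer port + (A) at `W`
  by_cases hres : (3 : ℤ) ∣ D₀.c ∨ (3 ∣ W₀.tamagawaProduct ∧
      ¬ ∃ (q : ℕ) (_ : Fact q.Prime), q ∣ W₀.conductorNorm ℤ ∧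
        (q ≠ 3 → ¬ q ^ 2 ∣ W₀.conductorNorm ℤ ∧ ¬ 3 ∣ (W₀.baseChange ℚ_[3]).localTamagawaNumber ℤ_[3]) ∧
        padicValNat 3 W₀.tamagawaProduct ≤ padicValNat 3 ((W₀.baseChange ℚ_[q]).localTamagawaNumber ℤ_[q]))
  · obtain ⟨q, hq, hle⟩ := padicValNat_shaOrder_le_of_katoFineSelmer_rankZero hF.1 hGZK hmod W 3 hp2 hadd.1
      hadd.2 hj hI (hCS W hr hO hI hnsT hcm ⟨W₀, hE₀, hM₀, hNZ₀, D₀, hiso, hopt, hres⟩) hr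
    refine ⟨q, hq, ?_⟩
    rw [padicValNat_torsionOrder_eq_zero_of_irreducible W 3 hI] at hle
    simpa using hle
  have hc₀ : ¬ (3 : ℤ) ∣ D₀.c := fun h ↦ hres (Or.inl h)
  have hsingle₀ : 3 ∣ W₀.tamagawaProduct → ∃ (q : ℕ) (_ : Fact q.Prime), q ∣ W₀.conductorNorm ℤ ∧
      (q ≠ 3 → ¬ q ^ 2 ∣ W₀.conductorNorm ℤ ∧ ¬ 3 ∣ (W₀.baseChange ℚ_[3]).localTamagawaNumber ℤ_[3]) ∧
      padicValNat 3 W₀.tamagawaProduct ≤ padicValNat 3 ((W₀.baseChange ℚ_[q]).localTamagawaNumber ℤ_[q]) := by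
    intro ht
    by_contra hne
    exact hres (Or.inr ⟨ht, hne⟩)
  -- transports along `W ∼ W₀`: analytic rank, additivity with integral `j`, CM, `E[3]`, the `3`-adic tower
  have hr₀ : W₀.analyticRank = 0 := by rw [← analyticRank_eq_of_isIsogenous' hiso]; exact hr
  obtain ⟨hadd₀, hj₀⟩ := Addv.of_isIsogenous_of_padicValRat_j_nonneg (p := 3) hadd hj hiso
  obtain ⟨e, he⟩ :=
    Summit.BirchSwinnertonDyer.BirchSwinnertonDyer.Rank1Residual.exists_torsionIso_of_isIsogenous_of_irreducible
      (p := 3) hI hiso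
  have hI₀ : W₀.HasIrreducibleModPGaloisRep 3 :=
    GreenbergVatsal2000.hasIrreducibleModPGaloisRep_of_torsionIso e he hI
  have hns₀ : ¬ (∀ n : ℕ, W₀.HasSurjectiveModNGaloisRep (3 ^ n : ℕ)) := fun h ↦
    hnsT (KimAtThreeKolyvaginIsogenyTransport.towerSurjective_of_isIsogenous hiso.symm_of_charZero h)
  have hcm₀ : ¬ W₀.HasCM := fun h ↦ hcm ((X12.hasCM_iff_of_isIsogenous hiso).mpr h)
  -- rationality of `L(E₀,1)/Ω`: `#Ш_an(E) ∈ ℚ` from the L₀ body at `W`, moved by Cassels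
  obtain ⟨q, hq, -⟩ := h₂ W hr hO
  have hfinW : Finite W.sha := (hGZK W (by rw [hr]; exact zero_le_one)).2
  have hleadW : W.leadingLCoeff ≠ 0 := W.leadingLCoeff_ne_zero_holds (hmod W)
  obtain ⟨q', hq', -⟩ := X12.exists_shaAn_eq_of_isIsogenous hCassels hiso.symm_of_charZero hfinW hleadW 3 hq
  have hrat₀ := exists_ratio_rat_of_shaAn_rat_rankZero hGZK W₀ hr₀ hq'
  -- the twists' lower halves: `WildRankOne` at the minimal model of `E^{(d_K)}` (an O6 row), moved by Cassels
  have hlow₀ : ∀ (K : Type) [Field K] [NumberField K], IsImaginaryQuadratic K →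
      SatisfiesHeegnerHypothesis (W₀.conductorNorm ℤ) K → Odd (NumberField.discr K) →
      ∀ (Wd : WeierstrassCurve ℚ) [Wd.IsElliptic] [Wd.IsGloballyMinimal] (Cd : VariableChange ℚ),
        Cd • W₀.quadraticTwist (NumberField.discr K : ℚ) = Wd → Wd.analyticRank = 1 →
        MissingLowerBoundAt Wd 3 := by
    intro K _ _ hKq hHN₀ hodd Wd₀ _ _ Cd₀ hWd₀ hrd₀
    have hHN : SatisfiesHeegnerHypothesis (W.conductorNorm ℤ) K := by rw [← hN]; exact hHN₀
    have hD0 : (NumberField.discr K : ℚ) ≠ 0 := by exact_mod_cast NumberField.discr_ne_zero K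
    haveI : (W.quadraticTwist (NumberField.discr K : ℚ)).IsElliptic := W.isElliptic_quadraticTwist hD0
    haveI : (W₀.quadraticTwist (NumberField.discr K : ℚ)).IsElliptic := W₀.isElliptic_quadraticTwist hD0
    obtain ⟨Cd, hCd⟩ := hasGlobalMinimalModel_rat_holds (W.quadraticTwist (NumberField.discr K : ℚ))
    haveI : (Cd • W.quadraticTwist (NumberField.discr K : ℚ)).IsGloballyMinimal := hCd
    obtain ⟨hOd, -⟩ := classO6_twist_of_heegner W hO K hKq hHN hodd
      (Cd • W.quadraticTwist (NumberField.discr K : ℚ)) Cd rfl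
    haveI : NeZero (2 : ℚ) := ⟨two_ne_zero⟩
    have hisoT : IsIsogenous (Cd • W.quadraticTwist (NumberField.discr K : ℚ)) Wd₀ := by
      rw [← hWd₀]
      exact IsIsogenous.trans' (IsIsogenous.trans' (isIsogenous_of_smul _ Cd) (hiso.quadraticTwist hD0))
        (isIsogenous_smul _ Cd₀)
    have hrd : (Cd • W.quadraticTwist (NumberField.discr K : ℚ)).analyticRank = 1 := by
      rw [analyticRank_eq_of_isIsogenous' hisoT]; exact hrd₀
    have hlowd : MissingLowerBoundAt (Cd • W.quadraticTwist (NumberField.discr K : ℚ)) 3 :=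
      (lower_and_upper_of_missingPPartAt _ 3 (hR _ hrd hOd)).1
    have hfind : Finite (Cd • W.quadraticTwist (NumberField.discr K : ℚ)).sha :=
      (hGZK _ (by rw [hrd])).2
    have hleadd : (Cd • W.quadraticTwist (NumberField.discr K : ℚ)).leadingLCoeff ≠ 0 :=
      (Cd • W.quadraticTwist (NumberField.discr K : ℚ)).leadingLCoeff_ne_zero_holds (hmod _)
    exact X12.missingLowerBoundAt_of_isIsogenous hCassels hisoT.symm_of_charZero hfind hleadd hlowd
  -- the upper half at the optimal member, then back to `W` by Cassels
  have hup₀ : MissingUpperBoundAt W₀ 3 :=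
    WildUpperOptimalSharpRoadJ08S2b.missingUpperBoundAt_rankZero_of_optimalDatum_of_jetchev08TwoSplit_of_boundAtPTwoSplit hGZ hKo hMN hGZK
      hmod hnf hBFH hJ hJp W₀ 3
      hr₀ hp2 hadd₀ hj₀ hcm₀ hI₀ hns₀ D₀ hopt hc₀ hsingle₀ hrat₀ hlow₀
  have hfin₀ : Finite W₀.sha := (hGZK W₀ (by rw [hr₀]; exact zero_le_one)).2
  have hlead₀ : W₀.leadingLCoeff ≠ 0 := W₀.leadingLCoeff_ne_zero_holds (hmod W₀)
  exact X12.missingUpperBoundAt_of_isIsogenous hCassels hiso hfin₀ hlead₀ hup₀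

end Summit.BirchSwinnertonDyer.BirchSwinnertonDyer.Theorems.WildUpperOptimalSharpNodesJ08S2b

end
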